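import Literature.MathematicalPhysics.QuantumLattice.HubbardNNNHoppingThermodynamicLimit
import HarnessLib

/-!
# The one-particle REMOVAL cost of a two-graph (`t–t'`) Hubbard Hamiltonian, and the pair-removal cost

Topic `Literature/MathematicalPhysics/QuantumLattice`; companion of `HubbardOneParticleCost.lean`
(`groundEnergyAt_pred_le`, one graph) and `HubbardNNNHoppingThermodynamicLimit.lean`
(`groundEnergy_twoGraph_succ_le`, the ADDITION cost for two graphs). Everything is PROVED; no definition,
no named fact, no `sorry`.

For `H = hamiltonian G t U + hamiltonian G' t' U'` on a finite vertex set `Λ` with degrees `≤ Δ`, `≤ Δ'`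
and `K = 2(2Δ+1)(2|t|+|U|) + 2(2Δ'+1)(2|t'|+|U'|)` (the volume-uniform commutator bound
`‖[H, c_k]‖ ≤ K`, `HubbardCommutatorBound.lean`):

* **`groundEnergy_twoGraph_pred_le`** — `E(N − 1) ≤ E(N) + K · 2|Λ|/N` for `1 ≤ N ≤ 2|Λ|` (average the
  Rayleigh quotients of the `2|Λ|` trial vectors `c_k ψ`, `ψ` a unit `N`-particle ground state, total weight
  `Σ_k ‖c_k ψ‖² = N`, each energy `≤ E ‖c_kψ‖² + K`);
* **`groundEnergy_twoGraph_sub_two_le`** — `E(N − 2) ≤ E(N) + 2 · K · 2|Λ|/(N − 1)`, `2 ≤ N ≤ 2|Λ|`;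
* **`groundEnergy_twoGraph_le_add_pairs`** — `E(N) ≤ E(N + 2m) + m · (2 · K · 2|Λ|/(N + 1))` whenever
  `N + 2m ≤ 2|Λ|`: the minimum of the `(N + 2m)`-particle sector lies at most `O(m)` (uniformly in the
  volume at fixed density `N/(2|Λ|) > 0`) below the minimum of the `N`-particle sector. This is the
  SECTOR FLOOR used by the variational stationarity of the Koma–Tasaki tower (crew hubbard-obs, one-point
  route): the `m`-th tower level `(Δ†)^m ψ` has energy `E(N) + O_m(1)`, hence excess `O_m(1)` over the floor
  `E(N + 2m)` of its own sector.

References: D. Ruelle, *Statistical Mechanics: Rigorous Results* (1969), §3.4 (continuity of thermodynamic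
functions in the density; a priori bounds) [Ruelle1969]; H. Tasaki, *Physics and Mathematics of Quantum
Many-Body Systems* (2020), §2.1 (variational principle in finite volume) [Tasaki2020].
-/

noncomputable section

open Matrix Finset
open scoped ComplexOrder BigOperators Matrix.Norms.L2Operator InnerProductSpace

namespace Literature.MathematicalPhysics.QuantumLattice

namespace ThermodynamicLimit

section RemovalCost

variable {Λ : Type*} [LinearOrder Λ] [Fintype Λ] (G G' : SimpleGraph Λ) [DecidableRel G.Adj]
  [DecidableRel G'.Adj]

/-- A normalised ground state exists in every sector `N ≤ 2|Λ|` of the two-graph Hamiltonian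
(Hermitian, block diagonal in the particle number). [folklore] -/
private theorem exists_unit_groundState_twoGraph' (t U t' U' : ℝ) {N : ℕ}
    (hN : N ≤ 2 * Fintype.card Λ) :
    ∃ ψ : Fock (Orb Λ), IsNParticle N ψ ∧ star ψ ⬝ᵥ ψ = 1 ∧
      (hamiltonian G t U + hamiltonian G' t' U') *ᵥ ψ =
        ((groundEnergy (hamiltonian G t U + hamiltonian G' t' U') N : ℝ) : ℂ) • ψ := by
  classical
  set H := hamiltonian G t U + hamiltonian G' t' U' with hH
  have hc : N ≤ (Finset.univ : Finset (Orb Λ)).card := by rwa [Finset.card_univ, card_orb]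
  obtain ⟨s₀, -, hs₀⟩ := Finset.exists_subset_card_eq hc
  have hp : ∃ s : Finset (Orb Λ), s.card = N := ⟨s₀, hs₀⟩
  have hpres : PreservesSectors H :=
    (LiebThm1.preservesSectors_hamiltonian G t U).add (LiebThm1.preservesSectors_hamiltonian G' t' U')
  have hinv : ∀ s s' : Finset (Orb Λ), ¬(s.card = N) → s'.card = N → H s s' = 0 := by
    intro s s' hs hs'
    by_contra h
    have := hpres s s' h
    apply hs
    rw [card_eq_upPart_add_downPart, this.1, this.2, ← card_eq_upPart_add_downPart, hs']
  have hHerm : H.IsHermitian :=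
    (LiebThm1.hamiltonian_isHermitian G t U).add (LiebThm1.hamiltonian_isHermitian G' t' U')
  obtain ⟨⟨v, hv, hv0, hHv⟩, -⟩ := sector_groundState H hHerm
    (fun s : Finset (Orb Λ) => s.card = N) hp hinv (nParticleSubmodule N) (fun v => Iff.rfl)
  obtain ⟨c, -, hc1⟩ := exists_smul_unit hv0
  refine ⟨c • v, Submodule.smul_mem _ c hv, hc1, ?_⟩
  rw [mulVec_smul, hHv, smul_comm,
    groundEnergy_eq_minEnergyOn H N (nParticleSubmodule N) fun ψ => Iff.rfl]

omit [LinearOrder Λ] in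
/-- The homogeneous variational bound `E(N) ⟨φ, φ⟩ ≤ Re ⟨φ, H φ⟩` on the `N`-particle sector, for any
matrix `H`. [folklore] -/
private theorem groundEnergy_mul_norm_le' [LinearOrder Λ] (H : Matrix (Finset (Orb Λ)) (Finset (Orb Λ)) ℂ)
    {N : ℕ} {φ : Fock (Orb Λ)} (hφ : IsNParticle N φ) :
    groundEnergy H N * (star φ ⬝ᵥ φ).re ≤ (expect H φ).re := by
  by_cases h0 : φ = 0
  · subst h0
    simp [expect]
  obtain ⟨c, hc0, hc1⟩ := exists_smul_unit h0
  have hmem : IsNParticle N (c • φ) := (nParticleSubmodule N).smul_mem c hφ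
  have h2 : groundEnergy H N ≤ (expect H (c • φ)).re := groundEnergy_le_re_expect H hmem hc1
  have hcc : star c * c = ((‖c‖ ^ 2 : ℝ) : ℂ) := by
    rw [Complex.star_def, Complex.conj_mul']
    push_cast
    rfl
  unfold expect at h2
  rw [mulVec_smul, star_smul, smul_dotProduct, dotProduct_smul, smul_smul, hcc, smul_eq_mul,
    Complex.re_ofReal_mul] at h2
  rw [star_smul, smul_dotProduct, dotProduct_smul, smul_smul, hcc, smul_eq_mul] at hc1
  have h1 : ‖c‖ ^ 2 * (star φ ⬝ᵥ φ).re = 1 := by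
    have := congrArg Complex.re hc1
    rwa [Complex.re_ofReal_mul, Complex.one_re] at this
  have hpos : 0 < ‖c‖ ^ 2 := by positivity
  have key : ‖c‖ ^ 2 * (groundEnergy H N * (star φ ⬝ᵥ φ).re) ≤ ‖c‖ ^ 2 * (expect H φ).re :=
    calc ‖c‖ ^ 2 * (groundEnergy H N * (star φ ⬝ᵥ φ).re)
        = groundEnergy H N * (‖c‖ ^ 2 * (star φ ⬝ᵥ φ).re) := by ring
      _ = groundEnergy H N := by rw [h1, mul_one]
      _ ≤ ‖c‖ ^ 2 * (expect H φ).re := h2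
  exact le_of_mul_le_mul_left key hpos

/-- **The one-particle removal cost of a two-graph Hamiltonian.** On graphs `G`, `G'` of maximal degree
`≤ Δ`, `≤ Δ'`: `E(N − 1) ≤ E(N) + K · 2|Λ|/N` for `1 ≤ N ≤ 2|Λ|`,
`K = 2(2Δ+1)(2|t| + |U|) + 2(2Δ'+1)(2|t'| + |U'|)` (average the Rayleigh quotients of `c_k ψ`, `ψ` a
unit `N`-particle ground state: total weight `Σ_k ‖c_k ψ‖² = N`, energies `≤ E‖c_kψ‖² + ‖[H, c_k]‖`,
`‖[H, c_k]‖ ≤ K`). Ruelle (1969) §3.4 (continuity in the density). [cite: Ruelle1969, §3.4] -/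
theorem groundEnergy_twoGraph_pred_le {Δ Δ' : ℕ} (hΔ : ∀ x : Λ, #{y | G.Adj x y} ≤ Δ)
    (hΔ' : ∀ x : Λ, #{y | G'.Adj x y} ≤ Δ') (t U t' U' : ℝ) {N : ℕ} (hN1 : 1 ≤ N)
    (hN : N ≤ 2 * Fintype.card Λ) :
    groundEnergy (hamiltonian G t U + hamiltonian G' t' U') (N - 1) ≤
      groundEnergy (hamiltonian G t U + hamiltonian G' t' U') N +
        ((2 * Δ + 1 : ℕ) * (2 * (2 * |t| + |U|)) + (2 * Δ' + 1 : ℕ) * (2 * (2 * |t'| + |U'|))) *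
          (2 * Fintype.card Λ) / N := by
  classical
  set H := hamiltonian G t U + hamiltonian G' t' U' with hH
  set E := groundEnergy H N with hE
  set E' := groundEnergy H (N - 1) with hE'
  set K : ℝ := (2 * Δ + 1 : ℕ) * (2 * (2 * |t| + |U|)) + (2 * Δ' + 1 : ℕ) * (2 * (2 * |t'| + |U'|))
    with hK
  obtain ⟨ψ, hψN, hψ1, hHψ⟩ := exists_unit_groundState_twoGraph' G G' t U t' U' hN
  -- trial vectors and weights
  set φ : Orb Λ → Fock (Orb Λ) := fun k => annihilation k *ᵥ ψ with hφ
  set w : Orb Λ → ℝ := fun k => (star (φ k) ⬝ᵥ φ k).re with hw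
  have hψN' : IsNParticle (N - 1 + 1) ψ := by rwa [Nat.sub_add_cancel hN1]
  have hφN : ∀ k, IsNParticle (N - 1) (φ k) := fun k => IsNParticle.annihilation_mulVec_holds hψN' k
  -- total weight
  have hW : ∑ k, w k = N := by
    have h := congrArg Complex.re (sum_star_annihilation_mulVec_dotProduct hψN hψ1)
    rw [Complex.re_sum] at h
    rw [show ∑ k, w k = ∑ k : Orb Λ, (star (annihilation k *ᵥ ψ) ⬝ᵥ (annihilation k *ᵥ ψ)).re
      from rfl, h]
    simp
  have hWpos : (0 : ℝ) < N := by exact_mod_cast hN1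
  -- energies of the trial vectors
  have hnormψ : ‖(WithLp.toLp 2 ψ : EuclideanSpace ℂ (Finset (Orb Λ)))‖ = 1 := by
    have h := norm_toLp_sq ψ
    rw [hψ1, Complex.one_re] at h
    rwa [pow_eq_one_iff_of_nonneg (norm_nonneg _) two_ne_zero] at h
  have hnormφ : ∀ k, ‖(WithLp.toLp 2 (φ k) : EuclideanSpace ℂ (Finset (Orb Λ)))‖ ≤ 1 := by
    intro k
    calc ‖(WithLp.toLp 2 (φ k) : EuclideanSpace ℂ (Finset (Orb Λ)))‖
        ≤ ‖annihilation k‖ * ‖(WithLp.toLp 2 ψ : EuclideanSpace ℂ (Finset (Orb Λ)))‖ :=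
          norm_toLp_mulVec_le _ _
      _ ≤ 1 * 1 := by
          gcongr
          · exact norm_annihilation_le_one (ι := Orb Λ) k
          · exact hnormψ.le
      _ = 1 := one_mul _
  have hcomm : ∀ k, ‖H * annihilation k - annihilation k * H‖ ≤ K := by
    intro k
    have h1 := norm_commutator_hamiltonianWith_annihilation_le G hΔ t U 0 (ofLex k).1 (ofLex k).2
    have h2 := norm_commutator_hamiltonianWith_annihilation_le G' hΔ' t' U' 0 (ofLex k).1 (ofLex k).2
    rw [hamiltonianWith_zero, abs_zero, mul_zero, add_zero] at h1 h2
    have hsplit : H * annihilation k - annihilation k * H =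
        (hamiltonian G t U * annihilation k - annihilation k * hamiltonian G t U) +
          (hamiltonian G' t' U' * annihilation k - annihilation k * hamiltonian G' t' U') := by
      simp only [hH, add_mul, mul_add]
      abel
    rw [hsplit]
    exact (norm_add_le _ _).trans (add_le_add h1 h2)
  have hen : ∀ k, (star (φ k) ⬝ᵥ (H *ᵥ φ k)).re ≤ E * w k + K := by
    intro k
    have hsplit : H *ᵥ φ k = (E : ℂ) • φ k + (H * annihilation k - annihilation k * H) *ᵥ ψ := by
      simp only [hφ]
      rw [sub_mulVec, ← mulVec_mulVec, ← mulVec_mulVec, hHψ, mulVec_smul]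
      abel
    rw [hsplit, dotProduct_add, dotProduct_smul, smul_eq_mul, Complex.add_re, Complex.re_ofReal_mul,
      star_dotProduct_self_eq_re, Complex.ofReal_re]
    have hX : ‖star (φ k) ⬝ᵥ ((H * annihilation k - annihilation k * H) *ᵥ ψ)‖ ≤ K := by
      refine (norm_star_dotProduct_mulVec_le _ _ _).trans ?_
      rw [hnormψ, mul_one]
      calc _ ≤ 1 * K := mul_le_mul (hnormφ k) (hcomm k) (norm_nonneg _) zero_le_one
        _ = K := one_mul K
    have hX' := (Complex.re_le_norm _).trans hX
    change E * w k + _ ≤ E * w k + K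
    linarith
  -- variational bound on each trial vector, summed
  have hvar : ∀ k, E' * w k ≤ (star (φ k) ⬝ᵥ (H *ᵥ φ k)).re := fun k =>
    groundEnergy_mul_norm_le' H (hφN k)
  have hsum : E' * N ≤ E * N + K * (2 * Fintype.card Λ) := by
    have h1 : ∑ k, E' * w k ≤ ∑ k, (E * w k + K) :=
      Finset.sum_le_sum fun k _ => (hvar k).trans (hen k)
    rw [← Finset.mul_sum, hW, Finset.sum_add_distrib, ← Finset.mul_sum, hW, Finset.sum_const,
      Finset.card_univ, card_orb, nsmul_eq_mul] at h1
    push_cast at h1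
    linarith
  rw [show E + K * (2 * Fintype.card Λ) / N = (E * N + K * (2 * Fintype.card Λ)) / N by
    field_simp]
  rw [le_div_iff₀ hWpos]
  exact hsum

/-- **Pair removal**: `E(N − 2) ≤ E(N) + 2 · K · 2|Λ|/(N − 1)` for `2 ≤ N ≤ 2|Λ|` (two removal steps,
each of cost `≤ K · 2|Λ|/(N − 1)`). [cite: Ruelle1969, §3.4] -/
theorem groundEnergy_twoGraph_sub_two_le {Δ Δ' : ℕ} (hΔ : ∀ x : Λ, #{y | G.Adj x y} ≤ Δ)
    (hΔ' : ∀ x : Λ, #{y | G'.Adj x y} ≤ Δ') (t U t' U' : ℝ) {N : ℕ} (hN2 : 2 ≤ N)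
    (hN : N ≤ 2 * Fintype.card Λ) :
    groundEnergy (hamiltonian G t U + hamiltonian G' t' U') (N - 2) ≤
      groundEnergy (hamiltonian G t U + hamiltonian G' t' U') N +
        2 * (((2 * Δ + 1 : ℕ) * (2 * (2 * |t| + |U|)) + (2 * Δ' + 1 : ℕ) * (2 * (2 * |t'| + |U'|))) *
          (2 * Fintype.card Λ) / ((N : ℝ) - 1)) := by
  set K : ℝ := (2 * Δ + 1 : ℕ) * (2 * (2 * |t| + |U|)) + (2 * Δ' + 1 : ℕ) * (2 * (2 * |t'| + |U'|))
    with hK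
  have hK0 : 0 ≤ K := by positivity
  have hV0 : (0 : ℝ) ≤ 2 * Fintype.card Λ := by positivity
  -- step 1: `N → N − 1`
  have h1 := groundEnergy_twoGraph_pred_le G G' hΔ hΔ' t U t' U' (by omega : 1 ≤ N) hN
  -- step 2: `N − 1 → N − 2`
  have h2 := groundEnergy_twoGraph_pred_le G G' hΔ hΔ' t U t' U' (by omega : 1 ≤ N - 1) (by omega)
  rw [show N - 1 - 1 = N - 2 by omega] at h2
  rw [← hK] at h1 h2
  have hN1 : ((N - 1 : ℕ) : ℝ) = (N : ℝ) - 1 := by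
    rw [Nat.cast_sub (by omega : 1 ≤ N)]; simp
  rw [hN1] at h2
  have hNpos : (0 : ℝ) < (N : ℝ) - 1 := by
    have : (2 : ℝ) ≤ N := by exact_mod_cast hN2
    linarith
  have hNpos' : (0 : ℝ) < (N : ℝ) := by linarith
  -- `K·2|Λ|/N ≤ K·2|Λ|/(N − 1)`
  have hmono : K * (2 * Fintype.card Λ) / (N : ℝ) ≤ K * (2 * Fintype.card Λ) / ((N : ℝ) - 1) :=
    div_le_div_of_nonneg_left (mul_nonneg hK0 hV0) hNpos (by linarith)
  linarith

/-- **The sector floor of the tower**: `E(N) ≤ E(N + 2m) + m · (2 · K · 2|Λ|/(N + 1))` whenever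
`N + 2m ≤ 2|Λ|` — the `(N + 2m)`-particle minimum lies at most `O(m)` below the `N`-particle minimum,
uniformly in the volume at fixed positive density. [cite: Ruelle1969, §3.4] -/
theorem groundEnergy_twoGraph_le_add_pairs {Δ Δ' : ℕ} (hΔ : ∀ x : Λ, #{y | G.Adj x y} ≤ Δ)
    (hΔ' : ∀ x : Λ, #{y | G'.Adj x y} ≤ Δ') (t U t' U' : ℝ) {N : ℕ} :
    ∀ m : ℕ, N + 2 * m ≤ 2 * Fintype.card Λ →
      groundEnergy (hamiltonian G t U + hamiltonian G' t' U') N ≤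
        groundEnergy (hamiltonian G t U + hamiltonian G' t' U') (N + 2 * m) +
          m * (2 * (((2 * Δ + 1 : ℕ) * (2 * (2 * |t| + |U|)) + (2 * Δ' + 1 : ℕ) * (2 * (2 * |t'| + |U'|))) *
            (2 * Fintype.card Λ) / ((N : ℝ) + 1))) := by
  set K : ℝ := (2 * Δ + 1 : ℕ) * (2 * (2 * |t| + |U|)) + (2 * Δ' + 1 : ℕ) * (2 * (2 * |t'| + |U'|))
    with hK
  have hK0 : 0 ≤ K := by positivity
  have hV0 : (0 : ℝ) ≤ 2 * Fintype.card Λ := by positivity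
  intro m
  induction m with
  | zero => intro _; simp
  | succ m ih =>
      intro hm
      have h1 := ih (by omega)
      -- remove one pair from the `(N + 2(m+1))`-particle ground state
      have h2 := groundEnergy_twoGraph_sub_two_le G G' hΔ hΔ' t U t' U' (N := N + 2 * (m + 1))
        (by omega) hm
      rw [show N + 2 * (m + 1) - 2 = N + 2 * m by omega, ← hK] at h2
      -- the cost at particle number `N + 2(m+1)` is at most the cost at `N + 2`
      have hNpos : (0 : ℝ) < (N : ℝ) + 1 := by positivity
      have hle : ((N : ℝ) + 1) ≤ ((N + 2 * (m + 1) : ℕ) : ℝ) - 1 := by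
        push_cast; linarith
      have hmono : K * (2 * Fintype.card Λ) / (((N + 2 * (m + 1) : ℕ) : ℝ) - 1) ≤
          K * (2 * Fintype.card Λ) / ((N : ℝ) + 1) :=
        div_le_div_of_nonneg_left (mul_nonneg hK0 hV0) hNpos hle
      have hcast : ((m + 1 : ℕ) : ℝ) = m + 1 := by push_cast; ring
      rw [hcast]
      nlinarith [h1, h2, hmono]

end RemovalCost

/-! ### The `L × L` `t–t'` torus -/

/-- Every site of `ℤ/aℤ × ℤ/bℤ` has at most four diagonal neighbours (re-proof of the private lemma of
`HubbardNNNHoppingThermodynamicLimit`). [folklore] -/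
private theorem card_filter_diag_adj_le' (a b : ℕ) (p : Fin a ×ₗ Fin b) :
    #{q | (fermionRectTorusDiagGraph a b).Adj p q} ≤ 4 := by
  set x : ℕ := ((ofLex p).1 : ℕ) with hx
  set y : ℕ := ((ofLex p).2 : ℕ) with hy
  calc #{q | (fermionRectTorusDiagGraph a b).Adj p q}
      ≤ #({((x + 1) % a, (y + 1) % b), ((x + 1) % a, (y + (b - 1)) % b),
            ((x + (a - 1)) % a, (y + 1) % b), ((x + (a - 1)) % a, (y + (b - 1)) % b)} :
          Finset (ℕ × ℕ)) := by
        refine Finset.card_le_card_of_injOn (fun q => (((ofLex q).1 : ℕ), ((ofLex q).2 : ℕ))) ?_ ?_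
        · intro q hq
          rw [Finset.mem_coe, Finset.mem_filter, fermionRectTorusDiagGraph_adj_iff] at hq
          simp only [Finset.coe_insert, Finset.coe_singleton, Set.mem_insert_iff,
            Set.mem_singleton_iff, Prod.mk.injEq]
          obtain ⟨-, ⟨-, h1 | h1⟩, ⟨-, h2 | h2⟩⟩ := hq
          · exact Or.inl ⟨h1.symm, h2.symm⟩
          · exact Or.inr (Or.inl ⟨h1.symm, eq_mod_of_succ_mod_eq (ofLex p).2.isLt (ofLex q).2.isLt h2⟩)
          · exact Or.inr (Or.inr (Or.inl
              ⟨eq_mod_of_succ_mod_eq (ofLex p).1.isLt (ofLex q).1.isLt h1, h2.symm⟩))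
          · exact Or.inr (Or.inr (Or.inr ⟨eq_mod_of_succ_mod_eq (ofLex p).1.isLt (ofLex q).1.isLt h1,
              eq_mod_of_succ_mod_eq (ofLex p).2.isLt (ofLex q).2.isLt h2⟩))
        · intro q _ q' _ h
          simp only [Prod.mk.injEq] at h
          exact ofLex.injective (Prod.ext (Fin.ext h.1) (Fin.ext h.2))
    _ ≤ 4 := Finset.card_le_four

/-- **The sector floor of the tower on the `t–t'` torus `(ℤ/Lℤ)²`**: for `N + 2m ≤ 2L²`,
`E_L(N) ≤ E_L(N + 2m) + m · (2 · K · 2L²/(N + 1))` with `K = 18(2|t| + |U| + 2|t'|)` (both bond graphs of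
the torus have degree `≤ 4`; `groundEnergy_twoGraph_le_add_pairs` on the rectangular torus `L × L` and the
site bijection `groundEnergy_hubbardTorusTT'_eq_rect`). At density `N ≈ nL²`, `n > 0`, the constant is
`≤ 8Km/n`, uniformly in `L`. [cite: Ruelle1969, §3.4] -/
theorem groundEnergy_hubbardTorusTT'_le_add_pairs (L : ℕ) (t t' U : ℝ) {N m : ℕ}
    (h : N + 2 * m ≤ 2 * L ^ 2) :
    groundEnergy (hubbardTorusTT' L t t' U) N ≤
      groundEnergy (hubbardTorusTT' L t t' U) (N + 2 * m) +
        m * (2 * ((18 * (2 * |t| + |U| + 2 * |t'|)) * (2 * (L : ℝ) ^ 2) / ((N : ℝ) + 1))) := by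
  rw [groundEnergy_hubbardTorusTT'_eq_rect, groundEnergy_hubbardTorusTT'_eq_rect]
  have h' : N + 2 * m ≤ 2 * Fintype.card (Fin L ×ₗ Fin L) := by
    rw [card_rectSites]; nlinarith [h]
  have := groundEnergy_twoGraph_le_add_pairs (fermionRectTorusGraph L L) (fermionRectTorusDiagGraph L L)
    (Δ := 4) (Δ' := 4) (card_filter_fermionRectTorusGraph_adj_le L L) (card_filter_diag_adj_le' L L)
    t U t' 0 m h'
  unfold hubbardRectTorusTT'
  refine this.trans (le_of_eq ?_)
  rw [card_rectSites, abs_zero]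
  push_cast
  ring

end ThermodynamicLimit

end Literature.MathematicalPhysics.QuantumLattice

end
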